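import Literature.Analysis.InnerProduct.HilbertComplexHeatFlow
import Mathlib.MeasureTheory.Integral.IntervalIntegral.FundThmCalculus
import Mathlib.MeasureTheory.Function.L2Space
import Mathlib.Analysis.SpecialFunctions.ExpDeriv
import HarnessLib

/-!
# Calculus of the heat semigroup of a discrete Hilbert complex: `P_t` is compact for `t > 0` and `P_t → P_𝔥` in operator
# norm; the integrated identities `□∫₀ᵗ P_sf ds = f − P_tf`, `P_tu − u = −∫₀ᵗ P_s□u ds` and `d/dt ∫₀ᵗ P_sf ds = P_tf`
# (Gilkey §1.6; Arapura Thm 8.3.4 (c); Schmüdgen Prop. 6.8 (6.16)–(6.17), Lemma 6.9)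

Layer `Literature/Analysis/InnerProduct`, namespace `Literature.Analysis.InnerProduct`; sequel BY NAME of
`HilbertComplexHeatFlow` (heat family `P_teᵢ = e^{-tμᵢ}eᵢ` of the Laplacian `□ = TT* + S*S` of a Hilbert complex
`E →T F →S G` in an eigenbasis `□eᵢ = μᵢeᵢ`: `inner_eigenvector_heat`, `continuousOn_heat_apply`,
`norm_heat_sub_starProjection_le_mul_norm`, `inner_eigenvector_heat_sub_starProjection`), `HilbertComplexGreenOperatorDiagonal`
(`clm_eq_diagonalCLM_of_inner_basis`, `exists_lp_infty_of_norm_le`), `HilbertComplexSpectralGap`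
(`exists_isLeast_pos_eigenvalue`), `HilbertComplexLaplacianDiagonal` (`eq_zero_of_forall_inner_hilbertBasis_eq_zero`,
`exists_mem_laplacian_domain_of_summable`, `hasSum_sq_norm_inner_hilbertBasis`, `eigenvalue_nonneg`),
`HilbertComplexDiscreteSpectrum` (`inner_eigenvector_laplacian`) and the tree's
`UnboundedOperators/DiagonalOperatorCompact` (`HilbertBasis.isCompactOperator_diagonalCLM_of_tendsto_zero`).
Theorems only: no `def`, no named fact, no `sorry` (net debt 0).

## Sources (followed)

* **Gilkey, *Invariance Theory, the Heat Equation, and the Atiyah–Singer Index Theorem* (2nd ed. 1995), §1.6** [Gilkey1995]: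
  "`K(t, x, y) = ∑ₙ e^{-tλₙ}φₙ(x) ⊗ φₙ*(y)` … is an infinitely smooth function … for `t > 0`", and Lemma 1.6.5: "for
  `t > 0`, `e^{-tQ*Q}` and `e^{-tQQ*}` are in `Ψ_{-∞}`" (in particular compact) — here: `P_t = diag(e^{-tμᵢ})` with
  `e^{-tμᵢ} → 0` (`μᵢ → ∞`) is a compact diagonal operator for `t > 0`.
* **Arapura, *Algebraic Geometry over the Complex Numbers* (2012), §8.3 Thm 8.3.4 (c)** [Arapura2012]: "`T_tα` converges to
  a `C^∞` harmonic form `H(α)`" — here in OPERATOR norm, `‖P_t − P_𝔥‖ ≤ e^{-tλ₁}` by the spectral gap.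
* **Schmüdgen, *Unbounded Self-adjoint Operators on Hilbert Space* (GTM 265, 2012), §6.2** [Schmudgen2012]: the "smoothed
  elements" `x_t := ∫₀ᵗ T(s)x ds` ("Since the map `[a, a+t] ∋ s → T(s)x ∈ E` is continuous …, the integral exists"),
  **Lemma 6.9** "`lim_{t→+0} t⁻¹x_{a,t} = T(a)x`", and in the proof of Prop. 6.8 (with Prop. 6.14, `B = −□`):
  **(6.16)** `T(t)x − x = B∫₀ᵗ T(s)x ds` for `x ∈ E`, **(6.17)** `T(t)y − y = ∫₀ᵗ T(s)By ds` for `y ∈ 𝒟(B)`.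
  In the eigenbasis both rest on the scalar identity `μ∫₀ᵗ e^{-sμ} ds = 1 − e^{-tμ}` (valid for `μ = 0` too).

## Main statements

* §1 **`heat_eq_diagonalCLM`** (`P_t = b.diagonalCLM (e^{-tμᵢ})`), **`isCompactOperator_heat`** (`t > 0`),
  **`opNorm_heat_sub_starProjection_le`** (`‖P_t − P_𝔥‖ ≤ e^{-tλ₁}`), **`tendsto_heat_opNorm_atTop`** (`P_t → P_𝔥` in
  `ℬ(H)`).
* §2 **`intervalIntegrable_heat_apply`**, **`inner_eigenvector_intervalIntegral_heat`** (coordinates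
  `∫₀ᵗ e^{-sμᵢ} ds · (eᵢ, f)`), **`laplacian_intervalIntegral_heat`** ((6.16): `∫₀ᵗ P_sf ds ∈ D_□` and
  `□∫₀ᵗ P_sf ds = f − P_tf`), **`heat_apply_sub_self_eq_neg_intervalIntegral`** ((6.17): `P_tu − u = −∫₀ᵗ P_s□u ds`,
  `u ∈ D_□`), **`hasDerivWithinAt_intervalIntegral_heat`** (`d/dt ∫₀ᵗ P_sf ds = P_tf` from the right, Lemma 6.9).

## Technical notes

`F`-valued interval integrals `∫ s in 0..t, P s f` are Mathlib's `intervalIntegral` for the real structure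
`[NormedSpace ℝ F]` taken as an instance hypothesis (as in `HilbertComplexHeatFlowIntegral`; `Real.isScalarTower` makes it
compatible with `𝕜`); coordinates are computed by `intervalIntegral.integral_of_le` + `integral_inner`. The harmonic space
`𝔥 = N_S ∩ N_{T*}` is written out as `(ker S).map S.domain.subtype ⊓ (ker T†).map T†.domain.subtype`, `P_𝔥` is its
`starProjection`.
-/

open scoped InnerProductSpace LinearPMap
open Filter Topology Submodule Module.End MeasureTheory

namespace Literature.Analysis.InnerProduct

variable {𝕜 E F G : Type*} [RCLike 𝕜]
variable [NormedAddCommGroup E] [InnerProductSpace 𝕜 E] [CompleteSpace E]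
variable [NormedAddCommGroup F] [InnerProductSpace 𝕜 F] [CompleteSpace F]
variable [NormedAddCommGroup G] [InnerProductSpace 𝕜 G]
variable {T : E →ₗ.[𝕜] F} {S : F →ₗ.[𝕜] G} {L : F →ₗ.[𝕜] F} {R : F →L[𝕜] F}
variable {ι : Type*} {b : HilbertBasis ι 𝕜 F} {μ : ι → ℝ} {P : ℝ → F →L[𝕜] F}

/-! ### §1 `P_t` is a compact diagonal operator for `t > 0`, and `P_t → P_𝔥` in operator norm -/

omit [CompleteSpace E] [CompleteSpace F] in
/-- The symbol `(e^{-tμᵢ})` (`t ≥ 0`, `μᵢ ≥ 0`) is bounded by `1`, hence an element of `ℓ^∞`. [cite: Gilkey1995, §1.6] -/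
theorem exists_lp_infty_exp_neg_mul (hμ0 : ∀ i, 0 ≤ μ i) {t : ℝ} (ht : 0 ≤ t) :
    ∃ m : lp (fun _ : ι ↦ 𝕜) ⊤, ∀ i, m i = ((Real.exp (-(t * μ i)) : ℝ) : 𝕜) :=
  exists_lp_infty_of_norm_le (C := 1) fun i ↦ by
    rw [RCLike.norm_ofReal, abs_of_pos (Real.exp_pos _)]
    exact Real.exp_le_one_iff.2 (by nlinarith [hμ0 i])

omit [CompleteSpace E] [CompleteSpace F] in
/-- **`P_t = diag(e^{-tμᵢ})`**: the heat operator IS the tree's bounded diagonal operator `b.diagonalCLM m` for any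
`m ∈ ℓ^∞` with `mᵢ = e^{-tμᵢ}`. [cite: Gilkey1995, §1.6 ("`K(t,x,y) = ∑ e^{-tλₙ}φₙ(x) ⊗ φₙ*(y)`")] -/
theorem heat_eq_diagonalCLM
    (hP : ∀ t : ℝ, 0 ≤ t → ∀ i, P t (b i) = ((Real.exp (-(t * μ i)) : ℝ) : 𝕜) • (b i : F))
    {t : ℝ} (ht : 0 ≤ t) (m : lp (fun _ : ι ↦ 𝕜) ⊤) (hm : ∀ i, m i = ((Real.exp (-(t * μ i)) : ℝ) : 𝕜)) :
    P t = b.diagonalCLM m :=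
  clm_eq_diagonalCLM_of_inner_basis b m fun i f ↦ by rw [hm i, inner_eigenvector_heat hP ht f i]

omit [CompleteSpace E] in
/-- **`P_t` is compact for `t > 0`** when `μᵢ → ∞` (`e^{-tμᵢ} → 0`, a diagonal operator with null symbol).
[cite: Gilkey1995, §1.6 Lemma 1.6.5 ("`e^{-tQ*Q}` and `e^{-tQQ*}` are in `Ψ_{-∞}`")] -/
theorem isCompactOperator_heat
    (hP : ∀ t : ℝ, 0 ≤ t → ∀ i, P t (b i) = ((Real.exp (-(t * μ i)) : ℝ) : 𝕜) • (b i : F))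
    (hμ0 : ∀ i, 0 ≤ μ i) (htend : Tendsto μ cofinite atTop) {t : ℝ} (ht : 0 < t) : IsCompactOperator (P t) := by
  obtain ⟨m, hm⟩ := exists_lp_infty_exp_neg_mul (𝕜 := 𝕜) hμ0 ht.le
  rw [heat_eq_diagonalCLM hP ht.le m hm]
  refine b.isCompactOperator_diagonalCLM_of_tendsto_zero m ?_
  have e : (fun i ↦ ‖m i‖) = fun i ↦ Real.exp (-(t * μ i)) := by
    funext i; rw [hm i, RCLike.norm_ofReal, abs_of_pos (Real.exp_pos _)]
  rw [e]
  exact Real.tendsto_exp_atBot.comp (tendsto_neg_atTop_atBot.comp (htend.const_mul_atTop ht))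

/-- **`‖P_t − P_𝔥‖ ≤ e^{-tλ₁}`** for `t ≥ 0`, `λ₁ = μ i₁` the least positive eigenvalue (operator-norm form of the
convergence to the harmonic projection). [cite: Arapura2012, §8.3 Thm 8.3.4 (c); Gilkey1995, §1.6] -/
theorem opNorm_heat_sub_starProjection_le (hdT : Dense (T.domain : Set E)) (hdS : Dense (S.domain : Set F))
    (hdom : ∀ x : F, x ∈ L.domain ↔ (∃ hxT : x ∈ T†.domain, T† ⟨x, hxT⟩ ∈ T.domain) ∧
      (∃ hxS : x ∈ S.domain, S ⟨x, hxS⟩ ∈ S†.domain))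
    (hval : ∀ (x : L.domain) (hxT : (x : F) ∈ T†.domain) (hTx : T† ⟨x, hxT⟩ ∈ T.domain)
      (hxS : (x : F) ∈ S.domain) (hSx : S ⟨x, hxS⟩ ∈ S†.domain),
      L x = T ⟨T† ⟨x, hxT⟩, hTx⟩ + S† ⟨S ⟨x, hxS⟩, hSx⟩)
    (heig : ∀ i, ∃ h : (b i : F) ∈ L.domain, L ⟨b i, h⟩ = ((μ i : ℝ) : 𝕜) • (b i : F))
    (hP : ∀ t : ℝ, 0 ≤ t → ∀ i, P t (b i) = ((Real.exp (-(t * μ i)) : ℝ) : 𝕜) • (b i : F))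
    [((LinearMap.ker S.toFun).map S.domain.subtype ⊓
      (LinearMap.ker T†.toFun).map T†.domain.subtype).HasOrthogonalProjection]
    {i₁ : ι} (hmin : ∀ i, 0 < μ i → μ i₁ ≤ μ i) {t : ℝ} (ht : 0 ≤ t) :
    ‖P t - ((LinearMap.ker S.toFun).map S.domain.subtype ⊓
      (LinearMap.ker T†.toFun).map T†.domain.subtype).starProjection‖ ≤ Real.exp (-(t * μ i₁)) :=
  ContinuousLinearMap.opNorm_le_bound _ (Real.exp_pos _).le fun f ↦ by
    rw [sub_apply]
    exact norm_heat_sub_starProjection_le_mul_norm hdT hdS hdom hval heig hP hmin ht f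

/-- **`P_t → P_𝔥` in operator norm as `t → ∞`** (exponentially, by the spectral gap, when `□` has a positive eigenvalue;
`P_t = P_𝔥` for `t ≥ 0` otherwise). [cite: Arapura2012, §8.3 Thm 8.3.4 (c); Gilkey1995, §1.6] -/
theorem tendsto_heat_opNorm_atTop (hdT : Dense (T.domain : Set E)) (hdS : Dense (S.domain : Set F))
    (hdom : ∀ x : F, x ∈ L.domain ↔ (∃ hxT : x ∈ T†.domain, T† ⟨x, hxT⟩ ∈ T.domain) ∧
      (∃ hxS : x ∈ S.domain, S ⟨x, hxS⟩ ∈ S†.domain))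
    (hval : ∀ (x : L.domain) (hxT : (x : F) ∈ T†.domain) (hTx : T† ⟨x, hxT⟩ ∈ T.domain)
      (hxS : (x : F) ∈ S.domain) (hSx : S ⟨x, hxS⟩ ∈ S†.domain),
      L x = T ⟨T† ⟨x, hxT⟩, hTx⟩ + S† ⟨S ⟨x, hxS⟩, hSx⟩)
    (heig : ∀ i, ∃ h : (b i : F) ∈ L.domain, L ⟨b i, h⟩ = ((μ i : ℝ) : 𝕜) • (b i : F))
    (htend : Tendsto μ cofinite atTop)
    (hP : ∀ t : ℝ, 0 ≤ t → ∀ i, P t (b i) = ((Real.exp (-(t * μ i)) : ℝ) : 𝕜) • (b i : F))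
    [((LinearMap.ker S.toFun).map S.domain.subtype ⊓
      (LinearMap.ker T†.toFun).map T†.domain.subtype).HasOrthogonalProjection] :
    Tendsto (fun t ↦ P t) atTop (𝓝 ((LinearMap.ker S.toFun).map S.domain.subtype ⊓
      (LinearMap.ker T†.toFun).map T†.domain.subtype).starProjection) := by
  set Ph := ((LinearMap.ker S.toFun).map S.domain.subtype ⊓
    (LinearMap.ker T†.toFun).map T†.domain.subtype).starProjection with hPh
  rw [tendsto_iff_norm_sub_tendsto_zero]
  by_cases hex : ∃ i, 0 < μ i
  · obtain ⟨i₁, hi₁, hmin⟩ := exists_isLeast_pos_eigenvalue htend hex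
    have hbound : ∀ᶠ t : ℝ in atTop, ‖P t - Ph‖ ≤ Real.exp (-(t * μ i₁)) :=
      (eventually_ge_atTop 0).mono fun t ht ↦ opNorm_heat_sub_starProjection_le hdT hdS hdom hval heig hP hmin ht
    have hlim : Tendsto (fun t : ℝ ↦ Real.exp (-(t * μ i₁))) atTop (𝓝 0) :=
      Real.tendsto_exp_neg_atTop_nhds_zero.comp (tendsto_id.atTop_mul_const hi₁)
    exact squeeze_zero' (Eventually.of_forall fun t ↦ norm_nonneg _) hbound hlim
  · push Not at hex
    have hμ : ∀ i, μ i = 0 := fun i ↦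
      le_antisymm (hex i) (eigenvalue_nonneg hdT hdS hdom hval (b.orthonormal.ne_zero i) (heig i))
    have heq : ∀ᶠ t : ℝ in atTop, (0 : ℝ) = ‖P t - Ph‖ := (eventually_ge_atTop 0).mono fun t ht ↦ by
      rw [eq_comm, norm_eq_zero]
      ext f
      rw [sub_apply, zero_apply]
      refine eq_zero_of_forall_inner_hilbertBasis_eq_zero b fun i ↦ ?_
      rw [hPh, inner_eigenvector_heat_sub_starProjection hdT hdS hdom hval heig hP ht f i, if_pos (hμ i)]
    exact tendsto_const_nhds.congr' heq

/-! ### §2 Smoothed elements `∫₀ᵗ P_sf ds`: (6.16), (6.17) and Lemma 6.9 -/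

/-- `μ∫₀ᵗ e^{-sμ} ds = 1 − e^{-tμ}` (also for `μ = 0`), by the fundamental theorem of calculus for `−e^{-sμ}`.
[folklore] -/
private theorem mul_intervalIntegral_exp_neg_mul (m t : ℝ) :
    m * ∫ s in (0 : ℝ)..t, Real.exp (-(s * m)) = 1 - Real.exp (-(t * m)) := by
  have hderiv : ∀ s ∈ Set.uIcc (0 : ℝ) t,
      HasDerivAt (fun s : ℝ ↦ -Real.exp (-(s * m))) (m * Real.exp (-(s * m))) s := fun s _ ↦ by
    have h1 : HasDerivAt (fun x : ℝ ↦ -(x * m)) (-m) s := (hasDerivAt_mul_const m).neg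
    have h2 : HasDerivAt (fun x : ℝ ↦ -Real.exp (-(x * m))) (-(Real.exp (-(s * m)) * -m)) s := h1.exp.neg
    exact h2.congr_deriv (by ring)
  have hint : IntervalIntegrable (fun s : ℝ ↦ m * Real.exp (-(s * m))) volume 0 t :=
    (by fun_prop : Continuous fun s : ℝ ↦ m * Real.exp (-(s * m))).intervalIntegrable _ _
  have h := intervalIntegral.integral_eq_sub_of_hasDerivAt hderiv hint
  rw [intervalIntegral.integral_const_mul] at h
  rw [h, zero_mul, neg_zero, Real.exp_zero]
  ring

omit [CompleteSpace E] [CompleteSpace F] in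
/-- **`s ↦ P_sf` is integrable on `[0, t]`** ("the map `s → T(s)x` is continuous …, the integral exists").
[cite: Schmudgen2012, §6.2 (before Lemma 6.9)] -/
theorem intervalIntegrable_heat_apply
    (hP : ∀ t : ℝ, 0 ≤ t → ∀ i, P t (b i) = ((Real.exp (-(t * μ i)) : ℝ) : 𝕜) • (b i : F))
    (hμ0 : ∀ i, 0 ≤ μ i) (f : F) {t : ℝ} (ht : 0 ≤ t) : IntervalIntegrable (fun s ↦ P s f) volume 0 t :=
  ((continuousOn_heat_apply hP hμ0 f).mono (by
    rw [Set.uIcc_of_le ht]; exact Set.Icc_subset_Ici_self)).intervalIntegrable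

omit [CompleteSpace E] in
/-- Coordinates of the smoothed element: `(eᵢ, ∫₀ᵗ P_sf ds) = (∫₀ᵗ e^{-sμᵢ} ds)(eᵢ, f)` for `t ≥ 0`.
[cite: Schmudgen2012, §6.2 (6.16)–(6.17) (proof of Prop. 6.8), Exercise 6.14] -/
theorem inner_eigenvector_intervalIntegral_heat [NormedSpace ℝ F]
    (hP : ∀ t : ℝ, 0 ≤ t → ∀ i, P t (b i) = ((Real.exp (-(t * μ i)) : ℝ) : 𝕜) • (b i : F))
    (hμ0 : ∀ i, 0 ≤ μ i) (f : F) {t : ℝ} (ht : 0 ≤ t) (i : ι) :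
    ⟪b i, ∫ s in (0 : ℝ)..t, P s f⟫_𝕜 = ((∫ s in (0 : ℝ)..t, Real.exp (-(s * μ i)) : ℝ) : 𝕜) * ⟪b i, f⟫_𝕜 := by
  have hint : IntegrableOn (fun s ↦ P s f) (Set.Ioc 0 t) := (intervalIntegrable_heat_apply hP hμ0 f ht).1
  rw [intervalIntegral.integral_of_le ht, intervalIntegral.integral_of_le ht, ← integral_inner hint (b i),
    setIntegral_congr_fun measurableSet_Ioc (fun s hs ↦ inner_eigenvector_heat hP (le_of_lt hs.1) f i),
    integral_mul_const, integral_ofReal]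

/-- **(6.16) for `□`: `∫₀ᵗ P_sf ds ∈ D_□` and `□∫₀ᵗ P_sf ds = f − P_tf`** for every `f` and `t ≥ 0`
("`T(t)x − x = B∫₀ᵗ T(s)x ds`, `x ∈ E`", `B = −□`). Coordinates: `μᵢ∫₀ᵗ e^{-sμᵢ} ds (eᵢ, f) = (1 − e^{-tμᵢ})(eᵢ, f)`, and
`∑ (1 − e^{-tμᵢ})²|(eᵢ, f)|² ≤ ‖f‖²` puts the smoothed element in `D_□`. [cite: Schmudgen2012, Prop. 6.8 (proof, (6.16)),
Prop. 6.14] -/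
theorem laplacian_intervalIntegral_heat [NormedSpace ℝ F] (hdT : Dense (T.domain : Set E))
    (hdS : Dense (S.domain : Set F))
    (hdom : ∀ x : F, x ∈ L.domain ↔ (∃ hxT : x ∈ T†.domain, T† ⟨x, hxT⟩ ∈ T.domain) ∧
      (∃ hxS : x ∈ S.domain, S ⟨x, hxS⟩ ∈ S†.domain))
    (hval : ∀ (x : L.domain) (hxT : (x : F) ∈ T†.domain) (hTx : T† ⟨x, hxT⟩ ∈ T.domain)
      (hxS : (x : F) ∈ S.domain) (hSx : S ⟨x, hxS⟩ ∈ S†.domain),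
      L x = T ⟨T† ⟨x, hxT⟩, hTx⟩ + S† ⟨S ⟨x, hxS⟩, hSx⟩)
    (hR : ∀ u : F, ∃ h : R u ∈ L.domain, R u + L ⟨R u, h⟩ = u)
    (heig : ∀ i, ∃ h : (b i : F) ∈ L.domain, L ⟨b i, h⟩ = ((μ i : ℝ) : 𝕜) • (b i : F))
    (hP : ∀ t : ℝ, 0 ≤ t → ∀ i, P t (b i) = ((Real.exp (-(t * μ i)) : ℝ) : 𝕜) • (b i : F))
    (f : F) {t : ℝ} (ht : 0 ≤ t) :
    ∃ hw : (∫ s in (0 : ℝ)..t, P s f) ∈ L.domain, L ⟨∫ s in (0 : ℝ)..t, P s f, hw⟩ = f - P t f := by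
  have hμ0 : ∀ i, 0 ≤ μ i := fun i ↦ eigenvalue_nonneg hdT hdS hdom hval (b.orthonormal.ne_zero i) (heig i)
  set w : F := ∫ s in (0 : ℝ)..t, P s f with hw_def
  have hcoord : ∀ i, ((μ i : ℝ) : 𝕜) * ⟪b i, w⟫_𝕜 = (((1 - Real.exp (-(t * μ i))) : ℝ) : 𝕜) * ⟪b i, f⟫_𝕜 := fun i ↦ by
    rw [hw_def, inner_eigenvector_intervalIntegral_heat hP hμ0 f ht i, ← mul_assoc, ← RCLike.ofReal_mul,
      mul_intervalIntegral_exp_neg_mul]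
  -- `w ∈ D_□`
  have hcw : ∀ i, μ i ^ 2 * ‖⟪b i, w⟫_𝕜‖ ^ 2 ≤ ‖⟪b i, f⟫_𝕜‖ ^ 2 := fun i ↦ by
    have h1 : μ i ^ 2 * ‖⟪b i, w⟫_𝕜‖ ^ 2 = ‖((μ i : ℝ) : 𝕜) * ⟪b i, w⟫_𝕜‖ ^ 2 := by
      rw [norm_mul, RCLike.norm_ofReal, mul_pow, sq_abs]
    rw [h1, hcoord i, norm_mul, RCLike.norm_ofReal, mul_pow, sq_abs]
    have e1 : Real.exp (-(t * μ i)) ≤ 1 := Real.exp_le_one_iff.2 (by nlinarith [hμ0 i])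
    have e2 := Real.exp_pos (-(t * μ i))
    exact mul_le_of_le_one_left (sq_nonneg _) (pow_le_one₀ (by linarith) (by linarith))
  have hs : Summable fun i ↦ μ i ^ 2 * ‖⟪b i, w⟫_𝕜‖ ^ 2 :=
    Summable.of_nonneg_of_le (fun i ↦ by positivity) hcw (hasSum_sq_norm_inner_hilbertBasis b f).summable
  obtain ⟨hw, -⟩ := exists_mem_laplacian_domain_of_summable hdT hdS hdom hval hR heig hs
  refine ⟨hw, ?_⟩
  rw [← sub_eq_zero]
  refine eq_zero_of_forall_inner_hilbertBasis_eq_zero b fun i ↦ ?_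
  rw [inner_sub_right, inner_sub_right, inner_eigenvector_laplacian hdT hdS hdom hval (heig i) ⟨w, hw⟩,
    inner_eigenvector_heat hP ht f i]
  change ((μ i : ℝ) : 𝕜) * ⟪b i, w⟫_𝕜 - _ = 0
  rw [hcoord i]
  push_cast
  ring

/-- **(6.17) for `□`: `P_tu − u = −∫₀ᵗ P_s□u ds`** for `u ∈ D_□` and `t ≥ 0` ("`T(t)y − y = ∫₀ᵗ T(s)By ds`, `y ∈ 𝒟(B)`",
`B = −□`). [cite: Schmudgen2012, Prop. 6.8 (proof, (6.17)), Prop. 6.14] -/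
theorem heat_apply_sub_self_eq_neg_intervalIntegral [NormedSpace ℝ F] (hdT : Dense (T.domain : Set E))
    (hdS : Dense (S.domain : Set F))
    (hdom : ∀ x : F, x ∈ L.domain ↔ (∃ hxT : x ∈ T†.domain, T† ⟨x, hxT⟩ ∈ T.domain) ∧
      (∃ hxS : x ∈ S.domain, S ⟨x, hxS⟩ ∈ S†.domain))
    (hval : ∀ (x : L.domain) (hxT : (x : F) ∈ T†.domain) (hTx : T† ⟨x, hxT⟩ ∈ T.domain)
      (hxS : (x : F) ∈ S.domain) (hSx : S ⟨x, hxS⟩ ∈ S†.domain),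
      L x = T ⟨T† ⟨x, hxT⟩, hTx⟩ + S† ⟨S ⟨x, hxS⟩, hSx⟩)
    (heig : ∀ i, ∃ h : (b i : F) ∈ L.domain, L ⟨b i, h⟩ = ((μ i : ℝ) : 𝕜) • (b i : F))
    (hP : ∀ t : ℝ, 0 ≤ t → ∀ i, P t (b i) = ((Real.exp (-(t * μ i)) : ℝ) : 𝕜) • (b i : F))
    (u : L.domain) {t : ℝ} (ht : 0 ≤ t) :
    P t (u : F) - u = -∫ s in (0 : ℝ)..t, P s (L u) := by
  have hμ0 : ∀ i, 0 ≤ μ i := fun i ↦ eigenvalue_nonneg hdT hdS hdom hval (b.orthonormal.ne_zero i) (heig i)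
  rw [← sub_eq_zero]
  refine eq_zero_of_forall_inner_hilbertBasis_eq_zero b fun i ↦ ?_
  rw [inner_sub_right, inner_sub_right, inner_neg_right, inner_eigenvector_heat hP ht _ i,
    inner_eigenvector_intervalIntegral_heat hP hμ0 (L u) ht i, inner_eigenvector_laplacian hdT hdS hdom hval (heig i) u,
    ← mul_assoc, ← RCLike.ofReal_mul, mul_comm (∫ s in (0 : ℝ)..t, Real.exp (-(s * μ i))) (μ i),
    mul_intervalIntegral_exp_neg_mul]
  push_cast
  ring

omit [CompleteSpace E] in
/-- **Lemma 6.9 ∕ the fundamental theorem of calculus for the heat flow: `d/dr ∫₀ʳ P_sf ds |_{r=t⁺} = P_tf`** for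
`t ≥ 0` (right derivative within `[t, ∞)`; at `t = 0`: `r⁻¹∫₀ʳ P_sf ds → f`). [cite: Schmudgen2012, Lemma 6.9
("`lim_{t→+0} t⁻¹x_{a,t} = T(a)x`")] -/
theorem hasDerivWithinAt_intervalIntegral_heat [NormedSpace ℝ F]
    (hP : ∀ t : ℝ, 0 ≤ t → ∀ i, P t (b i) = ((Real.exp (-(t * μ i)) : ℝ) : 𝕜) • (b i : F))
    (hμ0 : ∀ i, 0 ≤ μ i) (f : F) {t : ℝ} (ht : 0 ≤ t) :
    HasDerivWithinAt (fun r ↦ ∫ s in (0 : ℝ)..r, P s f) (P t f) (Set.Ici t) t := by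
  have hcont := continuousOn_heat_apply hP hμ0 f
  refine intervalIntegral.integral_hasDerivWithinAt_right (intervalIntegrable_heat_apply hP hμ0 f ht) ?_ ?_
  · exact (hcont.mono fun s (hs : t < s) ↦ (ht.trans hs.le : 0 ≤ s)).stronglyMeasurableAtFilter_nhdsWithin
      measurableSet_Ioi t
  · exact (hcont t ht).mono fun s (hs : t < s) ↦ (ht.trans hs.le : 0 ≤ s)

end Literature.Analysis.InnerProduct
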